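import Summits.Langlands.Langlands.Theses.PhantomRMYoshida
import Summits.Langlands.Langlands.Theorems.IrreducibilityBySelfDualityReciprocityUpToIrreducibilityCorrespondsConj
import HarnessLib

/-!
# NECESSITY CERTIFICATE — crux stmt-Langlands-13643 `PhantomRMYoshida.PhantomRMJunction`
(crux-strategist gen 1 re-arm s1, planner-cstrat-stmt-Langlands-13643-s1-0, 2026-08-17)

The three OPEN-CORE stubs of the live line `Lines/PhantomRMJunctionOfPieces.lean` (v8, lead c19) —
`stub_weakExistenceIrreducible` (W_irr), `stub_pairCompatibility` (LGC_∃), `stub_weakAutomorphy` (B_w) —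
and the non-vacuity piece N are each CONSEQUENCES of the summit `_root_.Langlands` (hence, under the route
target `PhantomRMSector`, consequences of the crux J itself).  So every sorry-free line `S₁ → … → S_k → J`
proves each of W_irr, LGC_∃, B_w, N from its stubs: no alternative skeleton can drop or weaken a core.
The texts `WIrr`, `LGCExists`, `BW` below are the registered stub signatures VERBATIM.
-/

noncomputable section

set_option linter.dupNamespace false -- project-wide convention (`Summit.Langlands.Langlands`)

open scoped MatrixGroups NumberField
open Filter IsDedekindDomain Field
open Literature.NumberTheory.Automorphic Literature.NumberTheory.GaloisRepresentations

namespace Summit.Langlands.Langlands.Cruxes.PhantomRMJunction.Strategist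

/-- Verbatim signature of the registered stub `stub_weakExistenceIrreducible` (W_irr). -/
def WIrr : Prop :=
  ∀ (K : Type) [Field K] [NumberField K] (n : ℕ) (hcpt : Literature.NumberTheory.Automorphic.isCompact_glFiniteIntegralLevel n K), 0 < n → ∀ π : Literature.NumberTheory.Automorphic.CuspidalAutomorphicRepData n K hcpt, π.1.IsLAlgebraic → ∀ (ℓ : ℕ) [Fact ℓ.Prime] (ι : PadicAlgCl ℓ ≃+* ℂ), ∃ ρ : Literature.NumberTheory.GaloisRepresentations.FramedGaloisRep K (PadicAlgCl ℓ) n, ρ.toGaloisRep.IsIrreducible ∧ ((∀ᶠ v : IsDedekindDomain.HeightOneSpectrum (NumberField.RingOfIntegers K) in Filter.cofinite, ρ.IsUnramifiedAt v) ∧ ∀ (v : IsDedekindDomain.HeightOneSpectrum (NumberField.RingOfIntegers K)) (hv : ((ℓ : ℕ) : NumberField.RingOfIntegers K) ∈ v.asIdeal), (Literature.NumberTheory.PAdicHodge.fontainePstAdicCompletion v ℓ hv).IsDeRhamFramed (ρ.toLocal v)) ∧ ∀ᶠ v : IsDedekindDomain.HeightOneSpectrum (NumberField.RingOfIntegers K)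 in Filter.cofinite, Summit.Langlands.SatakeFrobCompatibleAt ι π.1 ρ v

/-- Verbatim signature of the registered stub `stub_pairCompatibility` (LGC_∃). -/
def LGCExists : Prop :=
  ∀ (K : Type) [Field K] [NumberField K], Nonempty (Summit.Langlands.ReciprocityData K) → ∃ Rec : Summit.Langlands.ReciprocityData K, ∀ (n : ℕ) (hcpt : Literature.NumberTheory.Automorphic.isCompact_glFiniteIntegralLevel n K), 0 < n → ∀ (π : Literature.NumberTheory.Automorphic.CuspidalAutomorphicRepData n K hcpt), π.1.IsLAlgebraic → ∀ (ℓ : ℕ) [Fact ℓ.Prime] (ι : PadicAlgCl ℓ ≃+* ℂ) (ρ : Literature.NumberTheory.GaloisRepresentations.FramedGaloisRep K (PadicAlgCl ℓ) n), ρ.toGaloisRep.IsIrreducible → ((∀ᶠ v : IsDedekindDomain.HeightOneSpectrum (NumberField.RingOfIntegers K) in Filter.cofinite, ρ.IsUnramifiedAt v) ∧ ∀ (v : IsDedekindDomain.HeightOneSpectrum (NumberField.RingOfIntegers K)) (hv : ((ℓ : ℕ) : NumberField.RingOfIntegers K) ∈ v.asIdeal), (Literature.NumberTheory.PAdicHodge.fontainePstAdicCompletion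 v ℓ hv).IsDeRhamFramed (ρ.toLocal v)) → (∀ᶠ v : IsDedekindDomain.HeightOneSpectrum (NumberField.RingOfIntegers K) in Filter.cofinite, Summit.Langlands.SatakeFrobCompatibleAt ι π.1 ρ v) → ∀ v : IsDedekindDomain.HeightOneSpectrum (NumberField.RingOfIntegers K), Summit.Langlands.LocalGlobalCompatibleAt Rec ι π.1 ρ v

/-- Verbatim signature of the registered stub `stub_weakAutomorphy` (B_w). -/
def BW : Prop :=
  ∀ (K : Type) [Field K] [NumberField K] (n : ℕ) (hcpt : Literature.NumberTheory.Automorphic.isCompact_glFiniteIntegralLevel n K), 0 < n → ∀ (ℓ : ℕ) [Fact ℓ.Prime] (ι : PadicAlgCl ℓ ≃+* ℂ) (ρ : Literature.NumberTheory.GaloisRepresentations.FramedGaloisRep K (PadicAlgCl ℓ) n), ρ.toGaloisRep.IsIrreducible → ((∀ᶠ v : IsDedekindDomain.HeightOneSpectrum (NumberField.RingOfIntegers K) in Filter.cofinite, ρ.IsUnramifiedAt v) ∧ ∀ (v : IsDedekindDomain.HeightOneSpectrum (NumberField.RingOfIntegers K)) (hv : ((ℓ : ℕ) : NumberField.RingOfIntegers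 K) ∈ v.asIdeal), (Literature.NumberTheory.PAdicHodge.fontainePstAdicCompletion v ℓ hv).IsDeRhamFramed (ρ.toLocal v)) → ∃ π : Literature.NumberTheory.Automorphic.CuspidalAutomorphicRepData n K hcpt, π.1.IsLAlgebraic ∧ ∀ᶠ v : IsDedekindDomain.HeightOneSpectrum (NumberField.RingOfIntegers K) in Filter.cofinite, Summit.Langlands.SatakeFrobCompatibleAt ι π.1 ρ v

/-- Text of piece N (= item stmt-Langlands-17930). -/
def NText : Prop :=
  ∀ (K : Type) [Field K] [NumberField K], Nonempty (Summit.Langlands.ReciprocityData K)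

/-- N is a conjunct of the summit. -/
theorem nText_of_langlands (h : _root_.Langlands) : NText :=
  fun K _ _ => (h K).1

/-- W_irr is a consequence of the summit: clause (A) at any pinned datum, weakened to a.e. Satake
matching; the pinned Fontaine datum `ReciprocityData.pst` is `fontainePstAdicCompletion` by `rfl`. -/
theorem wIrr_of_langlands (h : _root_.Langlands) : WIrr := by
  intro K _ _ n hcpt hn π hπ ℓ _ ι
  obtain ⟨⟨Rec⟩, hcorr⟩ := h K
  obtain ⟨ρ, hirr, hgeom, hc, -⟩ := (hcorr Rec n hn hcpt).1 π hπ ℓ ι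
  exact ⟨ρ, hirr, ⟨hgeom.1, fun v hv => hgeom.2 v hv⟩, hc.1⟩

/-- B_w is a consequence of the summit: clause (B) at any pinned datum, weakened. -/
theorem bw_of_langlands (h : _root_.Langlands) : BW := by
  intro K _ _ n hcpt hn ℓ _ ι ρ hirr hgeom
  obtain ⟨⟨Rec⟩, hcorr⟩ := h K
  obtain ⟨π, hL, hc⟩ := (hcorr Rec n hn hcpt).2 ℓ ι ρ hirr ⟨hgeom.1, fun v hv => hgeom.2 v hv⟩
  exact ⟨π, hL, hc.1⟩

/-- LGC_∃ is a consequence of the summit: take ANY pinned datum; an irreducible a.e.-compatible `ρ` is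
conjugate to the avatar of clause (A) (Chebotarev + Brauer–Nesbitt, landed
`corresponds_of_exists_corresponds`), and `Corresponds` is conjugation-invariant. -/
theorem lgcExists_of_langlands (h : _root_.Langlands) : LGCExists := by
  intro K _ _ hne
  obtain ⟨Rec⟩ := hne
  refine ⟨Rec, ?_⟩
  intro n hcpt hn π hπ ℓ _ ι ρ hirr _hgeom hsat v
  obtain ⟨ρ', -, -, hc', -⟩ := ((h K).2 Rec n hn hcpt).1 π hπ ℓ ι
  exact (Summit.Langlands.Langlands.Theorems.ReciprocityUpToIrreducibility.corresponds_of_exists_corresponds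
    hirr hsat ⟨ρ', hc'⟩).2 v

/-- Hence, under the route target, the crux J forces all three cores and N. -/
theorem cores_of_junction (hX : Summit.Langlands.Langlands.Theses.PhantomRMYoshida.PhantomRMSector)
    (hJ : Summit.Langlands.Langlands.Theses.PhantomRMYoshida.PhantomRMJunction) :
    WIrr ∧ LGCExists ∧ BW ∧ NText :=
  have h : _root_.Langlands := hJ hX
  ⟨wIrr_of_langlands h, lgcExists_of_langlands h, bw_of_langlands h, nText_of_langlands h⟩

end Summit.Langlands.Langlands.Cruxes.PhantomRMJunction.Strategist

end
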